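import Summits.RiemannHypothesis.RiemannHypothesis.Theorems.WeilTwoPrimeDeflE25ODef
import Summits.RiemannHypothesis.RiemannHypothesis.Theorems.WeilTwoPrimeDeflE25ODataPO29
import Literature.NumberTheory.LFunctions.WeilBlockRowsR
import HarnessLib

/-!
# Deflated two-prime certificate E25O: the materialized odd block agrees with `P_r + Σ μ ĉ ĉᵀ`, rows 50–59

`WeilCert.checkPmRowG` for certificate E25O (odd block), by `decide +kernel`. Pure proof file; nothing is asserted.
-/

set_option linter.dupNamespace false

noncomputable section

namespace Summit.RiemannHypothesis.RiemannHypothesis.Theorems.EvenWinsBeyondArch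

open Literature.NumberTheory.LFunctions

set_option maxHeartbeats 0 in
/-- Row 50 of the materialized odd block is row 50 of `P_r + Σ μ ĉ ĉᵀ` (certificate E25O). [folklore] -/
theorem checkPmRowG1_50_weilCertDeflE25O : weilCertDeflE25OBase.checkPmRowG weilCertDeflE25OP weilCertDeflE25OPmO 1 50 = true := by
  decide +kernel

set_option maxHeartbeats 0 in
/-- Row 51 of the materialized odd block is row 51 of `P_r + Σ μ ĉ ĉᵀ` (certificate E25O). [folklore] -/
theorem checkPmRowG1_51_weilCertDeflE25O : weilCertDeflE25OBase.checkPmRowG weilCertDeflE25OP weilCertDeflE25OPmO 1 51 = true := by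
  decide +kernel

set_option maxHeartbeats 0 in
/-- Row 52 of the materialized odd block is row 52 of `P_r + Σ μ ĉ ĉᵀ` (certificate E25O). [folklore] -/
theorem checkPmRowG1_52_weilCertDeflE25O : weilCertDeflE25OBase.checkPmRowG weilCertDeflE25OP weilCertDeflE25OPmO 1 52 = true := by
  decide +kernel

set_option maxHeartbeats 0 in
/-- Row 53 of the materialized odd block is row 53 of `P_r + Σ μ ĉ ĉᵀ` (certificate E25O). [folklore] -/
theorem checkPmRowG1_53_weilCertDeflE25O : weilCertDeflE25OBase.checkPmRowG weilCertDeflE25OP weilCertDeflE25OPmO 1 53 = true := by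
  decide +kernel

set_option maxHeartbeats 0 in
/-- Row 54 of the materialized odd block is row 54 of `P_r + Σ μ ĉ ĉᵀ` (certificate E25O). [folklore] -/
theorem checkPmRowG1_54_weilCertDeflE25O : weilCertDeflE25OBase.checkPmRowG weilCertDeflE25OP weilCertDeflE25OPmO 1 54 = true := by
  decide +kernel

set_option maxHeartbeats 0 in
/-- Row 55 of the materialized odd block is row 55 of `P_r + Σ μ ĉ ĉᵀ` (certificate E25O). [folklore] -/
theorem checkPmRowG1_55_weilCertDeflE25O : weilCertDeflE25OBase.checkPmRowG weilCertDeflE25OP weilCertDeflE25OPmO 1 55 = true := by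
  decide +kernel

set_option maxHeartbeats 0 in
/-- Row 56 of the materialized odd block is row 56 of `P_r + Σ μ ĉ ĉᵀ` (certificate E25O). [folklore] -/
theorem checkPmRowG1_56_weilCertDeflE25O : weilCertDeflE25OBase.checkPmRowG weilCertDeflE25OP weilCertDeflE25OPmO 1 56 = true := by
  decide +kernel

set_option maxHeartbeats 0 in
/-- Row 57 of the materialized odd block is row 57 of `P_r + Σ μ ĉ ĉᵀ` (certificate E25O). [folklore] -/
theorem checkPmRowG1_57_weilCertDeflE25O : weilCertDeflE25OBase.checkPmRowG weilCertDeflE25OP weilCertDeflE25OPmO 1 57 = true := by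
  decide +kernel

set_option maxHeartbeats 0 in
/-- Row 58 of the materialized odd block is row 58 of `P_r + Σ μ ĉ ĉᵀ` (certificate E25O). [folklore] -/
theorem checkPmRowG1_58_weilCertDeflE25O : weilCertDeflE25OBase.checkPmRowG weilCertDeflE25OP weilCertDeflE25OPmO 1 58 = true := by
  decide +kernel

set_option maxHeartbeats 0 in
/-- Row 59 of the materialized odd block is row 59 of `P_r + Σ μ ĉ ĉᵀ` (certificate E25O). [folklore] -/
theorem checkPmRowG1_59_weilCertDeflE25O : weilCertDeflE25OBase.checkPmRowG weilCertDeflE25OP weilCertDeflE25OPmO 1 59 = true := by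
  decide +kernel


end Summit.RiemannHypothesis.RiemannHypothesis.Theorems.EvenWinsBeyondArch
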